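import Literature.Probability.LatticeModels.IsoradialSquareGrid
import HarnessLib

/-!
# Transport of rhombic embeddings along a graph isomorphism and a bijection of faces

Bookkeeping companion of `Literature.Probability.LatticeModels.IsoradialGraphs` and
`Literature.Probability.LatticeModels.IsoradialSquareGrid`. A rhombic embedding
`emb : RhombicEmbedding G F` of a graph `G` on `V` with face type `F` is pure data (vertex
positions `z`, face-centre positions `c`, left/right faces of darts). Given a graph isomorphism
`φ : G₀ ≃g G` from a graph on another vertex type `V₀` and a bijection of face types
`eF : F ≃ F₀`, the *same picture* is a rhombic embedding `emb.transfer φ eF` of `G₀` with face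
type `F₀`, and every property of the embedding used by the isoradial-percolation files is
invariant:

* `RhombicEmbedding.transfer` and its `simp` interface (`transfer_z`, `transfer_c`,
  `transfer_leftFace`, `transfer_rightFace`, `halfAngle_transfer`);
* `IsIsoradial.transfer`, `HasBoundedAngles.transfer`;
* tracks: `dartSides_transfer`, `dartOppositeSide_transfer`, `sides_transfer`,
  `oppositeSide_transfer`, `IsTrack.transfer`, `IsTrack.of_transfer` (both directions are needed
  because the printed square-grid property quantifies over *all* tracks), `IsSimpleTrack.transfer`,
  and the invariance of `trackMeets`, `meetIndices`, `trackBetween`, `IsReparametrization`,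
  `CrossesInOrder` under an injective map of edge sets;
* the printed square-grid property SGP(I) of Grimmett–Manolescu (PTRF 159 (2014), §4.2):
  `IsSquareGridGM.transfer`, `SquareGridPropertyGM.transfer`, `HasSquareGridPropertyGM.transfer`.

Purpose: the per-graph facts of `Literature.Probability.Percolation.Isoradial` (section `GM`:
`gm_boxCrossing`, `gm_theta_critical_eq_zero`, `gm_universality_arms`) are universe-polymorphic
in `V, F`, whereas the uniform fact `gm_boxCrossingBounds_uniform` (GM 2014, Thm 3.1 in the form
(3.1)) quantifies over graphs on types in `Type`; a countable graph with an injective face-centre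
map is isomorphic to one living in `Type` (`V ↪ ℕ`, `F ↪ ℂ`), and this file supplies the
transport of structure along that isomorphism (the percolation half — measures and crossing
events — is in `Literature.Probability.Percolation.IsoradialUniverseTransfer`). Nothing here is
specific to isoradiality: it is transport of structure in the sense of Bourbaki, recorded
because Lean does not provide it for free.

## References

* G. R. Grimmett, I. Manolescu, *Bond percolation on isoradial graphs: criticality and
  universality*, PTRF 159 (2014) 273–327 = arXiv:1204.0505, §2.1 (rhombic embeddings), §4.2
  (tracks, SGP(I)).
* N. Bourbaki, *Theory of Sets*, Ch. IV §1 (transport of structure along bijections).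
-/

noncomputable section

namespace Literature.Probability.LatticeModels

/-! ### Track data under an injective map of edge sets -/

section EdgeMaps

variable {V W : Type*} {G : SimpleGraph V} {G' : SimpleGraph W}

/-- Meeting indices are unchanged when both tracks are pushed along an injective map of edge
sets (for tracks: along a graph isomorphism). [folklore] -/
theorem meetIndices_comp {g : G.edgeSet → G'.edgeSet} (hg : Function.Injective g)
    (r r' : ℤ → G.edgeSet) : meetIndices (g ∘ r) (g ∘ r') = meetIndices r r' := by
  ext m
  simp only [meetIndices, Function.comp_apply, Set.mem_setOf_eq, hg.eq_iff]

/-- `trackMeets` is unchanged along an injective map of edge sets. [folklore] -/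
theorem trackMeets_comp_iff {g : G.edgeSet → G'.edgeSet} (hg : Function.Injective g)
    (r r' : ℤ → G.edgeSet) : trackMeets (g ∘ r) (g ∘ r') ↔ trackMeets r r' := by
  simp only [trackMeets, Function.comp_apply, hg.eq_iff]

/-- `trackBetween` is unchanged along an injective map of edge sets. [folklore] -/
theorem trackBetween_comp {g : G.edgeSet → G'.edgeSet} (hg : Function.Injective g)
    (r r₁ r₂ : ℤ → G.edgeSet) :
    trackBetween (g ∘ r) (g ∘ r₁) (g ∘ r₂) = trackBetween r r₁ r₂ := by
  ext n
  simp only [trackBetween, meetIndices_comp hg, Set.mem_setOf_eq]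

/-- Being a reparametrisation is unchanged along an injective map. [folklore] -/
theorem isReparametrization_comp_iff {α β : Type*} {g : α → β} (hg : Function.Injective g)
    (r t : ℤ → α) : IsReparametrization (g ∘ r) (g ∘ t) ↔ IsReparametrization r t := by
  simp only [IsReparametrization, Function.comp_apply, hg.eq_iff]

/-- Crossing a family in order is unchanged along an injective map of edge sets. [folklore] -/
theorem crossesInOrder_comp_iff {g : G.edgeSet → G'.edgeSet} (hg : Function.Injective g)
    (r : ℤ → G.edgeSet) (t : ℤ → ℤ → G.edgeSet) :
    CrossesInOrder (g ∘ r) (fun i => g ∘ t i) ↔ CrossesInOrder r t := by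
  simp only [CrossesInOrder, meetIndices_comp hg]

end EdgeMaps

/-! ### Darts along a graph isomorphism -/

namespace RhombicEmbedding

variable {V V₀ F F₀ : Type*} {G : SimpleGraph V} {G₀ : SimpleGraph V₀}

/-- The dart of `G` corresponding to a dart of `G₀` under the isomorphism `φ : G₀ ≃g G`.
(Mathlib's `SimpleGraph.Hom.mapDart` for the underlying homomorphism; restated to keep the
components definitionally `φ d.fst`, `φ d.snd`.) [folklore] -/
def dartMap (φ : G₀ ≃g G) (d : G₀.Dart) : G.Dart :=
  ⟨(φ d.fst, φ d.snd), φ.map_adj_iff.mpr d.adj⟩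

/-- First vertex of the image dart. [folklore] -/
@[simp] theorem dartMap_fst (φ : G₀ ≃g G) (d : G₀.Dart) : (dartMap φ d).fst = φ d.fst := rfl

/-- Second vertex of the image dart. [folklore] -/
@[simp] theorem dartMap_snd (φ : G₀ ≃g G) (d : G₀.Dart) : (dartMap φ d).snd = φ d.snd := rfl

/-- `dartMap` commutes with reversal. [folklore] -/
@[simp] theorem dartMap_symm (φ : G₀ ≃g G) (d : G₀.Dart) :
    dartMap φ d.symm = (dartMap φ d).symm := rfl

/-- The edge of the image dart is the image edge. [folklore] -/
theorem dartMap_edge (φ : G₀ ≃g G) (d : G₀.Dart) :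
    (dartMap φ d).edge = Sym2.map φ d.edge := rfl

/-- `dartMap φ.symm` is inverse to `dartMap φ`. [folklore] -/
@[simp] theorem dartMap_symm_dartMap (φ : G₀ ≃g G) (d : G₀.Dart) :
    dartMap φ.symm (dartMap φ d) = d := by
  ext <;> simp [dartMap]

/-- `dartMap φ` is inverse to `dartMap φ.symm`. [folklore] -/
@[simp] theorem dartMap_dartMap_symm (φ : G₀ ≃g G) (d : G.Dart) :
    dartMap φ (dartMap φ.symm d) = d := by
  ext <;> simp [dartMap]

/-- `dartMap φ` is surjective. [folklore] -/
theorem dartMap_surjective (φ : G₀ ≃g G) : Function.Surjective (dartMap φ) :=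
  fun d => ⟨dartMap φ.symm d, dartMap_dartMap_symm φ d⟩

/-- The edge of `dartMap φ d` is `φ.mapEdgeSet` of the edge of `d`. [folklore] -/
theorem dartMap_edge_eq_mapEdgeSet (φ : G₀ ≃g G) (d : G₀.Dart) (e : G₀.edgeSet)
    (hd : d.edge = e) : (dartMap φ d).edge = (φ.mapEdgeSet e : G.edgeSet) := by
  rw [dartMap_edge, hd]
  rfl

/-- The reference dart of an edge of `G₀`, pushed to `G`, lies over the image edge. [folklore] -/
theorem dartMap_refDart_edge (φ : G₀ ≃g G) (e₀ : G₀.edgeSet) :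
    (dartMap φ (refDart e₀)).edge = (φ.mapEdgeSet e₀ : G.edgeSet) :=
  dartMap_edge_eq_mapEdgeSet φ _ _ (refDart_edge e₀)

/-- Pushing a track to `G₀` and back. [folklore] -/
theorem mapEdgeSet_comp_symm_comp (φ : G₀ ≃g G) (r : ℤ → G.edgeSet) :
    φ.mapEdgeSet ∘ (φ.mapEdgeSet.symm ∘ r) = r := by
  funext n; exact φ.mapEdgeSet.apply_symm_apply (r n)

/-- Pushing a track to `G` and back. [folklore] -/
theorem mapEdgeSet_symm_comp_comp (φ : G₀ ≃g G) (r₀ : ℤ → G₀.edgeSet) :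
    φ.mapEdgeSet.symm ∘ (φ.mapEdgeSet ∘ r₀) = r₀ := by
  funext n; exact φ.mapEdgeSet.symm_apply_apply (r₀ n)

/-! ### The transported embedding -/

/-- **Transport of a rhombic embedding** along a graph isomorphism `φ : G₀ ≃g G` and a bijection
of face types `eF : F ≃ F₀`: the vertex `v₀` of `G₀` sits at `z (φ v₀)`, the face `f₀` at
`c (eF⁻¹ f₀)`, and the faces left/right of a dart are those of the corresponding dart of `G`,
renamed by `eF`. It is the same drawing with relabelled vertices and faces.
(Transport of structure; Grimmett–Manolescu 2014, §2.1 for the data of a rhombic embedding.)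
[folklore] -/
def transfer (emb : RhombicEmbedding G F) (φ : G₀ ≃g G) (eF : F ≃ F₀) :
    RhombicEmbedding G₀ F₀ where
  z := emb.z ∘ φ
  c := emb.c ∘ eF.symm
  leftFace d := eF (emb.leftFace (dartMap φ d))
  rightFace d := eF (emb.rightFace (dartMap φ d))

variable (emb : RhombicEmbedding G F) (φ : G₀ ≃g G) (eF : F ≃ F₀)

/-- Vertex positions of the transported embedding. [folklore] -/
@[simp] theorem transfer_z (v : V₀) : (emb.transfer φ eF).z v = emb.z (φ v) := rfl

/-- Face-centre positions of the transported embedding. [folklore] -/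
@[simp] theorem transfer_c (f : F₀) : (emb.transfer φ eF).c f = emb.c (eF.symm f) := rfl

/-- Left faces of the transported embedding. [folklore] -/
@[simp] theorem transfer_leftFace (d : G₀.Dart) :
    (emb.transfer φ eF).leftFace d = eF (emb.leftFace (dartMap φ d)) := rfl

/-- Right faces of the transported embedding. [folklore] -/
@[simp] theorem transfer_rightFace (d : G₀.Dart) :
    (emb.transfer φ eF).rightFace d = eF (emb.rightFace (dartMap φ d)) := rfl

/-- The transported embedding has the same half-angles. [folklore] -/
@[simp] theorem halfAngle_transfer (d : G₀.Dart) :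
    (emb.transfer φ eF).halfAngle d = emb.halfAngle (dartMap φ d) := by
  simp [halfAngle, transfer]

variable {emb φ eF}

/-- Isoradiality is transported. (Grimmett–Manolescu 2014, §2.1.) [folklore] -/
theorem IsIsoradial.transfer (h : emb.IsIsoradial) : (emb.transfer φ eF).IsIsoradial where
  norm_sub_eq_one d := by simpa [RhombicEmbedding.transfer] using h.norm_sub_eq_one (dartMap φ d)
  leftFace_symm d := by
    simp only [transfer_leftFace, transfer_rightFace, dartMap_symm, h.leftFace_symm]
  c_leftFace_ne d := by
    simpa [RhombicEmbedding.transfer] using h.c_leftFace_ne (dartMap φ d)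
  z_injective := h.z_injective.comp φ.injective

/-- The bounded-angles property BAP(ε) is transported. (Grimmett–Manolescu 2014, §2.1.)
[folklore] -/
theorem HasBoundedAngles.transfer {ε : ℝ} (h : emb.HasBoundedAngles ε) :
    (emb.transfer φ eF).HasBoundedAngles ε := fun d => by
  simpa only [halfAngle_transfer] using h (dartMap φ d)

/-! ### Sides and tracks -/

section Sides

/-- The relabelling of corner–centre pairs. [folklore] -/
def sideMap (φ : G₀ ≃g G) (eF : F ≃ F₀) : V × F ≃ V₀ × F₀ where
  toFun p := (φ.symm p.1, eF p.2)
  invFun q := (φ q.1, eF.symm q.2)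
  left_inv p := by simp [RelIso.apply_symm_apply]
  right_inv q := by simp [RelIso.symm_apply_apply]

/-- `sideMap` on a pair. [folklore] -/
@[simp] theorem sideMap_apply (p : V × F) : sideMap φ eF p = (φ.symm p.1, eF p.2) := rfl

variable [DecidableEq V] [DecidableEq F] [DecidableEq V₀] [DecidableEq F₀]

/-- The sides of the rhombus of a dart of the transported embedding are the relabelled sides of
the rhombus of the corresponding dart. [folklore] -/
theorem dartSides_transfer (d : G₀.Dart) :
    (emb.transfer φ eF).dartSides d = (emb.dartSides (dartMap φ d)).map (sideMap φ eF).toEmbedding := by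
  simp [dartSides, Finset.map_insert, Finset.map_singleton, sideMap, RelIso.symm_apply_apply]

/-- The opposite-side map of the rhombus of a dart of the transported embedding is the conjugate
of the opposite-side map of the corresponding dart. [folklore] -/
theorem dartOppositeSide_transfer (d : G₀.Dart) (p : V × F) :
    (emb.transfer φ eF).dartOppositeSide d (sideMap φ eF p) =
      sideMap φ eF (emb.dartOppositeSide (dartMap φ d) p) := by
  have h1 : ((d.fst, eF (emb.leftFace (dartMap φ d))) : V₀ × F₀) =
      sideMap φ eF (φ d.fst, emb.leftFace (dartMap φ d)) := by simp [RelIso.symm_apply_apply]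
  have h2 : ((d.snd, eF (emb.rightFace (dartMap φ d))) : V₀ × F₀) =
      sideMap φ eF (φ d.snd, emb.rightFace (dartMap φ d)) := by simp [RelIso.symm_apply_apply]
  have h3 : ((d.snd, eF (emb.leftFace (dartMap φ d))) : V₀ × F₀) =
      sideMap φ eF (φ d.snd, emb.leftFace (dartMap φ d)) := by simp [RelIso.symm_apply_apply]
  have h4 : ((d.fst, eF (emb.rightFace (dartMap φ d))) : V₀ × F₀) =
      sideMap φ eF (φ d.fst, emb.rightFace (dartMap φ d)) := by simp [RelIso.symm_apply_apply]
  simp only [dartOppositeSide, transfer_leftFace, transfer_rightFace, h1, h2, h3, h4,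
    (sideMap φ eF).injective.eq_iff, dartMap_fst, dartMap_snd]
  split_ifs <;> rfl

/-- Under isoradiality the side set of a rhombus only depends on the edge of the dart.
(Grimmett–Manolescu 2014, §2.1.) [folklore] -/
theorem dartSides_eq_of_edge_eq (h : emb.IsIsoradial) {d₁ d₂ : G.Dart} (hd : d₁.edge = d₂.edge) :
    emb.dartSides d₁ = emb.dartSides d₂ := by
  rcases (SimpleGraph.dart_edge_eq_iff d₁ d₂).1 hd with rfl | rfl
  · rfl
  · exact emb.dartSides_symm h d₂

/-- Under isoradiality the opposite-side map of a rhombus only depends on the edge of the dart.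
(Grimmett–Manolescu 2014, §2.1.) [folklore] -/
theorem dartOppositeSide_eq_of_edge_eq (h : emb.IsIsoradial) {d₁ d₂ : G.Dart}
    (hd : d₁.edge = d₂.edge) : emb.dartOppositeSide d₁ = emb.dartOppositeSide d₂ := by
  rcases (SimpleGraph.dart_edge_eq_iff d₁ d₂).1 hd with rfl | rfl
  · rfl
  · exact emb.dartOppositeSide_symm h d₂

/-- The sides of the rhombus of an edge of the transported embedding are the relabelled sides
of the rhombus of the image edge (isoradiality makes `sides` independent of the reference
dart). [folklore] -/
theorem sides_transfer (h : emb.IsIsoradial) (e₀ : G₀.edgeSet) :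
    (emb.transfer φ eF).sides e₀ =
      (emb.sides (φ.mapEdgeSet e₀)).map (sideMap φ eF).toEmbedding := by
  unfold sides
  rw [dartSides_transfer, emb.dartSides_eq_of_edge_eq h
    ((dartMap_refDart_edge (φ := φ) e₀).trans (refDart_edge _).symm)]

/-- The opposite-side map of an edge of the transported embedding is the conjugate of that of
the image edge. [folklore] -/
theorem oppositeSide_transfer (h : emb.IsIsoradial) (e₀ : G₀.edgeSet) (p : V × F) :
    (emb.transfer φ eF).oppositeSide e₀ (sideMap φ eF p) =
      sideMap φ eF (emb.oppositeSide (φ.mapEdgeSet e₀) p) := by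
  unfold oppositeSide
  rw [dartOppositeSide_transfer, emb.dartOppositeSide_eq_of_edge_eq h
    ((dartMap_refDart_edge (φ := φ) e₀).trans (refDart_edge _).symm)]

/-- **Tracks are transported**: `r₀` is a track of the transported embedding iff its image is a
track of the original one (the witnessing sides are relabelled by `sideMap`).
(Grimmett–Manolescu 2014, §4.2: tracks are sequences of rhombi, i.e. of edges.) [folklore] -/
theorem isTrack_transfer_iff (h : emb.IsIsoradial) (r₀ : ℤ → G₀.edgeSet) :
    (emb.transfer φ eF).IsTrack r₀ ↔ emb.IsTrack (φ.mapEdgeSet ∘ r₀) := by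
  constructor
  · rintro ⟨s₀, hs₀⟩
    refine ⟨(sideMap φ eF).symm ∘ s₀, fun n => ?_⟩
    obtain ⟨h1, h2, h3, h4⟩ := hs₀ n
    have hs : ∀ m, s₀ m = sideMap φ eF ((sideMap φ eF).symm (s₀ m)) := fun m => by simp
    refine ⟨?_, ?_, ?_, ?_⟩
    · rw [hs n, sides_transfer h, Finset.mem_map_equiv, Equiv.symm_apply_apply] at h1
      exact h1
    · rw [hs n, sides_transfer h, Finset.mem_map_equiv, Equiv.symm_apply_apply] at h2
      exact h2
    · exact fun h' => h3 (φ.mapEdgeSet.injective h')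
    · rw [hs n, hs (n - 1), oppositeSide_transfer h] at h4
      exact (sideMap φ eF).injective h4
  · rintro ⟨s, hs⟩
    refine ⟨sideMap φ eF ∘ s, fun n => ?_⟩
    obtain ⟨h1, h2, h3, h4⟩ := hs n
    refine ⟨?_, ?_, ?_, ?_⟩
    · rw [Function.comp_apply, sides_transfer h, Finset.mem_map_equiv, Equiv.symm_apply_apply]
      exact h1
    · rw [Function.comp_apply, sides_transfer h, Finset.mem_map_equiv, Equiv.symm_apply_apply]
      exact h2
    · exact fun h' => h3 (congrArg φ.mapEdgeSet h')
    · rw [Function.comp_apply, Function.comp_apply, oppositeSide_transfer h]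
      exact congrArg _ h4

/-- Simple tracks are transported. (Grimmett–Manolescu 2014, §4.2.) [folklore] -/
theorem isSimpleTrack_transfer_iff (h : emb.IsIsoradial) (r₀ : ℤ → G₀.edgeSet) :
    (emb.transfer φ eF).IsSimpleTrack r₀ ↔ emb.IsSimpleTrack (φ.mapEdgeSet ∘ r₀) := by
  unfold IsSimpleTrack
  rw [isTrack_transfer_iff h, φ.mapEdgeSet.injective.of_comp_iff]

/-- **The printed square grid is transported**: if `(s, t)` is a square grid with parameter `I`
of `emb` (Grimmett–Manolescu 2014, §4.2, SGP(I) clauses (a)–(c) as rendered by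
`IsSquareGridGM`), then the pulled-back families form a square grid with parameter `I` of the
transported embedding. Clause (b) quantifies over all tracks, which is why both directions of
`isTrack_transfer_iff` are used. [folklore] -/
theorem IsSquareGridGM.transfer (h : emb.IsIsoradial) {s t : ℤ → ℤ → G.edgeSet} {I : ℕ}
    (hst : emb.IsSquareGridGM s t I) :
    (emb.transfer φ eF).IsSquareGridGM (fun i => φ.mapEdgeSet.symm ∘ s i)
      (fun j => φ.mapEdgeSet.symm ∘ t j) I := by
  have hg : Function.Injective φ.mapEdgeSet.symm := φ.mapEdgeSet.symm.injective
  refine ⟨fun i => ?_, fun j => ?_, ?_, ?_, fun i j => ?_, fun r₀ hr₀ hnr => ?_,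
    fun r₀ hr₀ hnr => ?_, fun i j => ?_, fun i j => ?_⟩
  · rw [isSimpleTrack_transfer_iff h, mapEdgeSet_comp_symm_comp φ]
    exact hst.isSimpleTrack_left i
  · rw [isSimpleTrack_transfer_iff h, mapEdgeSet_comp_symm_comp φ]
    exact hst.isSimpleTrack_right j
  · intro i j hij
    rw [trackMeets_comp_iff hg]
    exact hst.pairwise_not_trackMeets_left hij
  · intro i j hij
    rw [trackMeets_comp_iff hg]
    exact hst.pairwise_not_trackMeets_right hij
  · rw [isReparametrization_comp_iff hg]
    exact hst.not_isReparametrization i j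
  · have hr : emb.IsTrack (φ.mapEdgeSet ∘ r₀) := (isTrack_transfer_iff h r₀).1 hr₀
    have hr₀' : r₀ = φ.mapEdgeSet.symm ∘ (φ.mapEdgeSet ∘ r₀) := (mapEdgeSet_symm_comp_comp φ r₀).symm
    have hnr' : ∀ i, ¬ IsReparametrization (φ.mapEdgeSet ∘ r₀) (s i) := fun i hi =>
      hnr i (by rw [hr₀']; exact (isReparametrization_comp_iff hg _ _).2 hi)
    have := hst.crossesInOrder_left _ hr hnr'
    rw [hr₀', crossesInOrder_comp_iff hg]
    exact this
  · have hr : emb.IsTrack (φ.mapEdgeSet ∘ r₀) := (isTrack_transfer_iff h r₀).1 hr₀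
    have hr₀' : r₀ = φ.mapEdgeSet.symm ∘ (φ.mapEdgeSet ∘ r₀) := (mapEdgeSet_symm_comp_comp φ r₀).symm
    have hnr' : ∀ j, ¬ IsReparametrization (φ.mapEdgeSet ∘ r₀) (t j) := fun j hj =>
      hnr j (by rw [hr₀']; exact (isReparametrization_comp_iff hg _ _).2 hj)
    have := hst.crossesInOrder_right _ hr hnr'
    rw [hr₀', crossesInOrder_comp_iff hg]
    exact this
  · simpa only [trackBetween_comp hg] using hst.encard_trackBetween_left_lt i j
  · simpa only [trackBetween_comp hg] using hst.encard_trackBetween_right_lt i j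

/-- **SGP(I) is transported.** (Grimmett–Manolescu 2014, §4.2.) [folklore] -/
theorem SquareGridPropertyGM.transfer (h : emb.IsIsoradial) {I : ℕ}
    (hsgp : emb.SquareGridPropertyGM I) : (emb.transfer φ eF).SquareGridPropertyGM I := by
  obtain ⟨s, t, hst⟩ := hsgp
  exact ⟨_, _, hst.transfer h⟩

/-- **The printed square-grid property SGP is transported.** (Grimmett–Manolescu 2014, §4.2.)
[folklore] -/
theorem HasSquareGridPropertyGM.transfer (h : emb.IsIsoradial)
    (hsgp : emb.HasSquareGridPropertyGM) : (emb.transfer φ eF).HasSquareGridPropertyGM := by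
  obtain ⟨I, hI⟩ := hsgp
  exact ⟨I, hI.transfer h⟩

end Sides

end RhombicEmbedding

end Literature.Probability.LatticeModels
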